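import Summits.QuantumFields.QCD.Theses.AdaptiveBlockFermions
import Literature.MathematicalPhysics.QuantumLattice.AdaptiveCoarseSystem
import Literature.MathematicalPhysics.QuantumFieldTheory.WilsonFlow

/-!
# Sketch — first lemmas of the crux-idea cards for `CollarModeTail` (stmt-QuantumFields-9495)

Planner scratch (crux-ideate round 1, ideator 1). Nothing here is filed; the `def … : Prop` below
are the "First lemma" signatures quoted in `Ideas/*.md`, checked to elaborate.
-/

namespace Summit.QuantumFields.QCD.Cruxes.CollarModeTail.Ideas

open scoped BigOperators Matrix ComplexConjugate
open MeasureTheory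
open Literature.MathematicalPhysics.QuantumLattice Literature.MathematicalPhysics.QuantumFieldTheory
  Literature.Probability.LatticeModels

/-- The `N_f = 0` slice of the crux (the refuters' repair `C′₀`): the crux body with `Nf := 0`.
It is IMPLIED by `CollarModeTail` (below), not conversely — every card of this round attacks this
slice and says so. -/
def CollarModeTailQuenched : Prop :=
  ∀ (sch : QCDScheme 0), sch.HasAsymptoticScaling → ∀ c₀ : ℝ, 0 < c₀ → ∃ ℓ : ℝ, 0 < ℓ ∧ ∃ t : ℝ, 0 < t ∧ ∃ K : ℝ, ∀ᶠ k in Filter.atTop, ∀ (S b : ℕ), sch.L k ≤ S → 2 ≤ b → (b : ℝ) * sch.a k ≤ ℓ → ∀ m ∈ Set.Icc (-1 : ℝ) 1, ∀ B : Fin 4 → ℕ, let collar : (TorusSite 4 (2 * S + 1) × Fin 3 × Fin 4) → Prop := fun p => ∀ i, ((((p.1 i).val / b : ℕ) : ZMod ((2 * S + 1) / b)) - ((B i : ℕ) : ZMod ((2 * S + 1) / b)) = 0 ∨ (((p.1 i).val / b : ℕ) : ZMod ((2 * S + 1) / b)) - ((B i : ℕ) : ZMod ((2 * S + 1) / b))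 = 1 ∨ (((p.1 i).val / b : ℕ) : ZMod ((2 * S + 1) / b)) - ((B i : ℕ) : ZMod ((2 * S + 1) / b)) = -1); let n : GaugeConfig 4 (2 * S + 1) (Matrix.specialUnitaryGroup (Fin 3) ℂ) → ℕ := fun U => Fintype.card {i // (Matrix.isHermitian_conjTranspose_mul_self ((wilsonDirac (fundamentalRep (Fin 3)) U m 1).toBlock collar collar)).eigenvalues i < (c₀ / b) ^ 2}; ∫ U, Real.exp (t * (n U : ℝ)) ∂(wilsonMeasure (d := 4) (L := 2 * S + 1) (fundamentalRep (Fin 3)) (sch.β k)) ≤ K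

/-- The crux implies its quenched slice (specialisation `Nf := 0`). -/
theorem quenched_of_collarModeTail
    (h : Summit.QuantumFields.QCD.Theses.AdaptiveBlockFermions.CollarModeTail) :
    CollarModeTailQuenched :=
  fun sch hs => h 0 sch hs

/-! ## Card `flow-spot-localisation` — first lemma: the spot rank inequality

Changing the gauge field on a set `E` of edges changes the collar-restricted Wilson–Dirac operator
by a matrix of rank `≤ 12·|E|` (each edge enters through the two rank-`6` hopping blocks
`½(1∓γ_μ) ⊗ ρ(U_e)^{±1}`), so by singular-value interlacing the local mode count moves by at most
`12·|E|`, at every threshold and every mass. This is the `A′ = 0`, lattice-scale skeleton of spot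
localisation (modes beyond the reference count are charged to the places where the field differs). -/
def SpotRankInequality : Prop :=
  ∀ (L b : ℕ) [NeZero L] (U V : GaugeConfig 4 L (Matrix.specialUnitaryGroup (Fin 3) ℂ))
    (E : Finset (Edge 4 L)), (∀ e, e ∉ E → U e = V e) → ∀ (m t : ℝ) (B : Fin 4 → ℕ),
      collarModeCount (wilsonDirac (fundamentalRep (Fin 3)) U m 1)
          (fun p i => (p.1 i).val / b) (L / b) B t
        ≤ collarModeCount (wilsonDirac (fundamentalRep (Fin 3)) V m 1)
            (fun p i => (p.1 i).val / b) (L / b) B t + 12 * E.card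

/-! ## Card `wilson-hole-pricing` — first lemma: free hole coercivity on the torus

For the free field `U ≡ 1` and every bare mass `m ∈ [−1, 0]` the periodic Wilson–Dirac operator is
coercive with constant `|m|`: `‖D_W(1,m) v‖² ≥ m² ‖v‖²` (momentum space:
`(m + W)² + Σ sin² − m² = W(W + 2m) + Σ_μ w_μ(2 − w_μ) ≥ W² − Σ w_μ² = 2Σ_{μ<ν} w_μ w_ν ≥ 0`,
`w_μ = 1 − cos p_μ`; equality at `p = 0`). Hence a crossing of `γ₅(D_W(U,·))` at `m ∈ [−1,0)`
needs `‖D_W(U) − D_W(1^g)‖ ≥ |m|` for every pure gauge `1^g`: the norm floor that pricing upgrades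
to an ACTION floor. (Operator form of route SpectralDefectExtinction's support `HoleLemma`.) -/
def FreeHoleCoercivity : Prop :=
  ∀ (L : ℕ) [NeZero L] (m : ℝ), -1 ≤ m → m ≤ 0 →
    ∀ v : (TorusSite 4 L × Fin 3 × Fin 4) → ℂ,
      let D := wilsonDirac (fundamentalRep (Fin 3))
        (fun _ : Edge 4 L => (1 : Matrix.specialUnitaryGroup (Fin 3) ℂ)) m 1
      m ^ 2 * (star v ⬝ᵥ v).re ≤ (star (D *ᵥ v) ⬝ᵥ (D *ᵥ v)).re

/-! ## Card `heated-flow-pressure` — first lemma: the crude heating bound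

By the tree's flow monotonicity `wilsonAction_wilsonFlow_le`, tilting the Wilson measure by the
FLOWED action is dominated by tilting by the raw action, i.e. by heating the whole system:
`E_β[exp(θβ S_W(V_τ U))] ≤ Z((1−θ)β)/Z(β)` (`0 ≤ θ`, `0 ≤ β`, `0 ≤ τ`). The card's lever is the
sharpening of the right side from the whole-system heating entropy `exp(12 θ' |T|)` to the
flowed-mode entropy `exp(C θ |T| / τ²)`. -/
def HeatedFlowDomination : Prop :=
  ∀ (S : ℕ) (β θ τ : ℝ), 0 ≤ β → 0 ≤ θ → 0 ≤ τ →
    ∫ U, Real.exp (θ * β * wilsonAction (fundamentalRep (Fin 3)) (wilsonFlow τ U))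
        ∂(wilsonMeasure (d := 4) (L := 2 * S + 1) (fundamentalRep (Fin 3)) β)
      ≤ (partitionFunction (d := 4) (L := 2 * S + 1) (fundamentalRep (Fin 3)) ((1 - θ) * β)).toReal /
          (partitionFunction (d := 4) (L := 2 * S + 1) (fundamentalRep (Fin 3)) β).toReal

end Summit.QuantumFields.QCD.Cruxes.CollarModeTail.Ideas
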